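import Summits.RiemannHypothesis.RiemannHypothesis.Theorems.SemilocalDeletionDipole
import HarnessLib

/-!
# Deleting one prime with ALL its visible powers: exact perturbation, alternating combs, SHARPNESS of `2·log p/(√p + 1)`

`SemilocalDeletionCliff.lean` treats one visible power (`c < log p`).  On a window `[−c, c]` with `2c < (m+1)·log p` the powers
`p, …, p^m` are visible and (§1, `re_weilSemilocalQuadratic_erase_sub_eq_sum_pow`, from the finite atom sum of the Literature)

  `Re Q_{S∖p}(g) − Re Q_S(g) = Σ_{d=1}^{m} (log p/(√p)^d)·Re(k(d·log p) + k(−d·log p))`,  `k = g ⋆ g̃`,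

`log p` times the zero-diagonal Kac–Murdock–Szegő form at ratio `ρ = 1/√p` in the lattice autocorrelations of `g`
(`SemilocalDeletionCausalFilter.kms_autocorrelation_floor`, p379019, bounds it below by `−(2ρ/(1+ρ))‖g‖₂²`, i.e. the ALL-WINDOW
floor `2·log p/(√p + 1)`).  §2–§3 prove that this constant is SHARP: for the alternating comb `G = Σ_{i≤n} (−1)^i h(· + nL/2 − iL)`
of a block `h ∈ C(δ)`, `2δ < L = log p` (a test function on `[−(nL/2 + δ), nL/2 + δ]`, `‖G‖₂² = (n+1)‖h‖₂²`, lattice autocorrelations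
`k_G(dL) = (−1)^d (n+1−d)‖h‖₂²` — `weilConv_weilReflect_comb_lag`),

* `re_weilSemilocalQuadratic_erase_comb`: `Re Q_{S∖p}(G) − Re Q_S(G) = 2·log p·‖h‖₂²·Σ_{d<n} (n−d)(−ρ)^{d+1}` (EXACT; `n = 1` is the dipole
  of `SemilocalDeletionDipole`: `−(log p/√p)‖G‖₂²`);
* `re_weilSemilocalQuadratic_erase_comb_le`: `≤ −(2·log p/(√p + 1))·((n−1)/(n+1))·‖G‖₂²` (closed form `comb_sum_closed`);
* `exists_re_weilSemilocalQuadratic_erase_sub_le`: for every `n` some test function on `[−(n log p/2 + log p/4), …]` has deletion Rayleigh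
  quotient `≤ −(2·log p/(√p + 1))·(n−1)/(n+1)` — the all-window floor is attained in the limit `n → ∞`, at rate `2F_p/(n+1)`.

The comb of an even block is even for even `n` and odd for odd `n` — the sector alternation with the number of visible powers seen in
the lineage-E data (HOME/cc-s2-1/gen12/TOEPLITZ-LAW.md).  Nothing here bears on RH; these are statements about truncated Weil forms.
-/

set_option linter.dupNamespace false

noncomputable section

open Complex Filter Set MeasureTheory
open scoped Real Topology ComplexConjugate

namespace Summit.RiemannHypothesis.RiemannHypothesis.Theorems.SemilocalDeletionAllPowers

open Literature.NumberTheory.LFunctions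
open Summit.RiemannHypothesis.RiemannHypothesis.Theorems.SemilocalDeletionCliff
open Summit.RiemannHypothesis.RiemannHypothesis.Theorems.SemilocalDeletionDipole
open Summit.RiemannHypothesis.RiemannHypothesis.Theorems.HandoffSemilocalEnergy

variable {g : ℝ → ℂ}

/-! ## §1  The exact perturbation with all visible powers -/

variable {S : Finset ℕ} {p : ℕ}

/-- At `p^d`, `d ≠ 0`, `p ∈ S`: the deleted weight is `log p/(√p)^d`. -/
theorem coeff_sub_erase_prime_pow (hp : p.Prime) (hpS : p ∈ S) {d : ℕ} (hd : d ≠ 0) :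
    weilSemilocalCoeff S (p ^ d) - weilSemilocalCoeff (S.erase p) (p ^ d) = Real.log p / Real.sqrt p ^ d := by
  have hsq : ∀ n : ℕ, Real.sqrt ((p : ℝ) ^ n) = Real.sqrt p ^ n := fun n ↦ by
    induction n with
    | zero => simp
    | succ n ih => rw [pow_succ, Real.sqrt_mul (by positivity), ih, pow_succ]
  unfold weilSemilocalCoeff
  have h1 : (p ^ d).primeFactors ⊆ S := by
    rw [Nat.primeFactors_prime_pow hd hp, Finset.singleton_subset_iff]; exact hpS
  have h2 : ¬ (p ^ d).primeFactors ⊆ S.erase p := by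
    rw [Nat.primeFactors_prime_pow hd hp, Finset.singleton_subset_iff]; exact Finset.notMem_erase p S
  rw [if_pos h1, if_neg h2, ArithmeticFunction.vonMangoldt_apply_pow hd, ArithmeticFunction.vonMangoldt_apply_prime hp,
    sub_zero]
  push_cast
  rw [hsq]

/-- **The deletion perturbation with all visible powers (real form).** For `p ∈ S` prime and `tsupport g ⊆ [−c, c]` with
`2c < (m+1)·log p`: `Re Q_{S∖p}(g) − Re Q_S(g) = Σ_{d=1}^{m} (log p/(√p)^d)·Re(k(d log p) + k(−d log p))`, `k = g ⋆ g̃`. -/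
theorem re_weilSemilocalQuadratic_erase_sub_eq_sum_pow (hg : IsWeilTest g) (hp : p.Prime) (hpS : p ∈ S) {c : ℝ}
    (hsupp : tsupport g ⊆ Icc (-c) c) {m : ℕ} (hm : 2 * c < (m + 1) * Real.log p) :
    (weilSemilocalQuadratic (S.erase p) g).re - (weilSemilocalQuadratic S g).re =
      ∑ d ∈ Finset.range m, Real.log p / Real.sqrt p ^ (d + 1) *
        (weilConv g (weilReflect g) ((d + 1) * Real.log p) + weilConv g (weilReflect g) (-((d + 1) * Real.log p))).re := by
  classical
  set k := weilConv g (weilReflect g) with hkdef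
  have hlp : 0 < Real.log p := Real.log_pos (by exact_mod_cast hp.one_lt)
  set N : ℕ := max ⌊Real.exp (2 * c)⌋₊ (p ^ m) with hNdef
  have hN : 2 * c < Real.log ((N : ℝ) + 1) := by
    rw [Real.lt_log_iff_exp_lt (by positivity)]
    have h1 : Real.exp (2 * c) < (⌊Real.exp (2 * c)⌋₊ : ℝ) + 1 := Nat.lt_floor_add_one _
    have h2 : ((⌊Real.exp (2 * c)⌋₊ : ℕ) : ℝ) ≤ N := by exact_mod_cast le_max_left _ _
    linarith
  have hks : tsupport k ⊆ Icc (-Real.log ((N : ℝ) + 1)) (Real.log ((N : ℝ) + 1)) :=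
    (tsupport_weilConv_weilReflect_subset (a := c) hg.2 hsupp).trans (Icc_subset_Icc (by linarith) (by linarith))
  have hk : IsWeilTest k := hg.weilConv hg.weilReflect
  set w : ℕ → ℝ := fun n ↦ weilSemilocalCoeff S n - weilSemilocalCoeff (S.erase p) n with hw
  set f : ℕ → ℂ := fun n ↦ ((w n : ℝ) : ℂ) * (k (Real.log n) + k (-Real.log n)) with hf
  -- the difference of the two forms is the finite atom sum over `n ≤ N`
  have hdiff : weilSemilocalQuadratic (S.erase p) g - weilSemilocalQuadratic S g = ∑ n ∈ Finset.range (N + 1), f n := by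
    have hS := weilSemilocalPrimeTerm_eq_sum_of_tsupport_subset S hk.1.continuous N hks
    have hS' := weilSemilocalPrimeTerm_eq_sum_of_tsupport_subset (S.erase p) hk.1.continuous N hks
    have hpt : weilSemilocalPrimeTerm S k - weilSemilocalPrimeTerm (S.erase p) k = ∑ n ∈ Finset.range (N + 1), f n := by
      rw [hS, hS', ← Finset.sum_sub_distrib]
      refine Finset.sum_congr rfl fun n _ ↦ ?_
      rw [hf, hw]; push_cast; ring
    unfold weilSemilocalQuadratic weilSemilocalFunctional
    rw [← hkdef]
    linear_combination hpt
  -- only the atoms `n = p^{d+1}`, `d < m`, survive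
  set e : ℕ → ℕ := fun d ↦ p ^ (d + 1) with he
  have heinj : Set.InjOn e (Finset.range m) := fun a _ b _ h ↦ by
    have := Nat.pow_right_injective hp.two_le h
    simpa using this
  have hsub : (Finset.range m).image e ⊆ Finset.range (N + 1) := by
    intro n hn
    obtain ⟨d, hd, rfl⟩ := Finset.mem_image.1 hn
    rw [Finset.mem_range] at hd ⊢
    have h3 : e d ≤ p ^ m := Nat.pow_le_pow_right hp.pos hd
    have h4 : p ^ m ≤ N := le_max_right _ _
    omega
  have hvan : ∀ n ∈ Finset.range (N + 1), n ∉ (Finset.range m).image e → f n = 0 := by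
    intro n _ hn
    rw [hf]; dsimp only
    by_cases hpow : ∃ d : ℕ, d ≠ 0 ∧ n = p ^ d
    · obtain ⟨d, hd, rfl⟩ := hpow
      -- then `d ≥ m + 1`, so `log n ≥ (m+1) log p > 2c` and both `k`-values vanish
      have hdm : m + 1 ≤ d := by
        by_contra hlt
        push Not at hlt
        refine hn (Finset.mem_image.2 ⟨d - 1, Finset.mem_range.2 (by omega), ?_⟩)
        rw [he]; dsimp only; rw [Nat.sub_add_cancel (Nat.one_le_iff_ne_zero.2 hd)]
      have hlog : 2 * c < |Real.log ((p ^ d : ℕ) : ℝ)| := by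
        push_cast
        rw [Real.log_pow, abs_of_nonneg (by positivity)]
        have : ((m : ℝ) + 1) * Real.log p ≤ d * Real.log p :=
          mul_le_mul_of_nonneg_right (by exact_mod_cast hdm) hlp.le
        linarith
      rw [hkdef, weilConv_weilReflect_eq_zero_of_lt hg hsupp hlog,
        weilConv_weilReflect_eq_zero_of_lt hg hsupp (by rwa [abs_neg]), add_zero, mul_zero]
    · push Not at hpow
      -- deleting `p` does not change the coefficient at `n` unless `n` is a positive power of `p`
      have hw0 : w n = 0 := by
        rw [hw]; dsimp only
        by_cases hpp : IsPrimePow n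
        · obtain ⟨q, e, hq, he, rfl⟩ := (isPrimePow_nat_iff _).1 hpp
          have hqp : q ≠ p := fun h ↦ hpow e he.ne' (by rw [h])
          rw [weilSemilocalCoeff_erase_prime_pow_of_ne S hq he.ne' hqp, sub_self]
        · rw [weilSemilocalCoeff_of_not_isPrimePow S hpp, weilSemilocalCoeff_of_not_isPrimePow (S.erase p) hpp, sub_self]
      rw [hw0]
      simp
  have hre : (weilSemilocalQuadratic (S.erase p) g).re - (weilSemilocalQuadratic S g).re =
      (∑ d ∈ Finset.range m, f (e d)).re := by
    rw [← Complex.sub_re, hdiff, ← Finset.sum_subset hsub hvan, Finset.sum_image heinj]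
  rw [hre, Complex.re_sum]
  refine Finset.sum_congr rfl fun d _ ↦ ?_
  rw [hf, hw, he]; dsimp only
  rw [coeff_sub_erase_prime_pow hp hpS (Nat.add_one_ne_zero d), Complex.re_ofReal_mul]
  push_cast
  rw [Real.log_pow]
  push_cast
  ring_nf

/-- Division-free closed form of the comb sum: `(1 − x)²·Σ_{d<n} (n − d)·x^{d+1} = n·x·(1 − x) − x²·(1 − x^n)`. -/
theorem comb_sum_closed (x : ℝ) (n : ℕ) :
    (1 - x) ^ 2 * ∑ d ∈ Finset.range n, ((n : ℝ) - d) * x ^ (d + 1) = n * x * (1 - x) - x ^ 2 * (1 - x ^ n) := by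
  induction n with
  | zero => simp
  | succ n ih =>
    have hsplit : ∑ d ∈ Finset.range (n + 1), (((n + 1 : ℕ) : ℝ) - d) * x ^ (d + 1) =
        (∑ d ∈ Finset.range n, ((n : ℝ) - d) * x ^ (d + 1)) + x * ∑ d ∈ Finset.range (n + 1), x ^ d := by
      calc ∑ d ∈ Finset.range (n + 1), (((n + 1 : ℕ) : ℝ) - d) * x ^ (d + 1)
          = ∑ d ∈ Finset.range (n + 1), (((n : ℝ) - d) * x ^ (d + 1) + x * x ^ d) :=
            Finset.sum_congr rfl fun d _ ↦ by push_cast; ring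
        _ = (∑ d ∈ Finset.range (n + 1), ((n : ℝ) - d) * x ^ (d + 1)) + ∑ d ∈ Finset.range (n + 1), x * x ^ d :=
            Finset.sum_add_distrib
        _ = (∑ d ∈ Finset.range n, ((n : ℝ) - d) * x ^ (d + 1)) + x * ∑ d ∈ Finset.range (n + 1), x ^ d := by
            rw [Finset.sum_range_succ, Finset.mul_sum]; simp
    have hgeom : (∑ d ∈ Finset.range (n + 1), x ^ d) * (x - 1) = x ^ (n + 1) - 1 := geom_sum_mul x (n + 1)
    rw [hsplit, mul_add, ih]
    have : (1 - x) ^ 2 * (x * ∑ d ∈ Finset.range (n + 1), x ^ d) = x * (1 - x) * (1 - x ^ (n + 1)) := by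
      have h2 : (1 - x) ^ 2 * (x * ∑ d ∈ Finset.range (n + 1), x ^ d) =
          -(x * (1 - x)) * ((∑ d ∈ Finset.range (n + 1), x ^ d) * (x - 1)) := by ring
      rw [h2, hgeom]; ring
    rw [this]; push_cast; ring

/-! ## §2  Alternating combs: `n+1` blocks `h ∈ C(δ)` at spacing `L = log p` with signs `(−1)^i` -/

section Comb

variable {h : ℝ → ℂ} {δ L : ℝ} {n : ℕ} {G : ℝ → ℂ}
  (hG : ∀ t : ℝ, G t = ∑ i ∈ Finset.range (n + 1), ((-1 : ℂ) ^ i) * h (t + n * L / 2 - i * L))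

/-- Blocks of the comb never overlap pointwise (`2δ < L`): `h(u + nL/2 − iL)·conj h(u − x + nL/2 − jL) = 0` unless the two arguments
differ by less than `2δ`, i.e. unless `x = (i − j)·L` when `x` is a multiple of `L`. -/
theorem block_mul_conj_block_eq_zero (hsupp : tsupport h ⊆ Icc (-δ) δ) (hL : 2 * δ < L) {i j : ℕ} {d : ℤ}
    (hne : (i : ℤ) ≠ j + d) (u : ℝ) :
    h (u + n * L / 2 - i * L) * conj (h (u - d * L + n * L / 2 - j * L)) = 0 := by
  refine mul_conj_eq_zero_of_far hsupp ?_
  have hdiff : u + n * L / 2 - i * L - (u - d * L + n * L / 2 - j * L) = ((j : ℤ) + d - i : ℤ) * L := by push_cast; ring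
  rw [hdiff, abs_mul]
  have hk : (1 : ℝ) ≤ |(((j : ℤ) + d - i : ℤ) : ℝ)| := by
    rw [← Int.cast_abs]
    exact_mod_cast Int.one_le_abs (by omega)
  have h1 : L ≤ |(((j : ℤ) + d - i : ℤ) : ℝ)| * |L| := (le_abs_self L).trans (le_mul_of_one_le_left (abs_nonneg L) hk)
  linarith

include hG

/-- The alternating comb of a test function is a test function. -/
theorem isWeilTest_comb (hh : IsWeilTest h) : IsWeilTest G := by
  have key : ∀ k : ℕ, IsWeilTest fun t ↦ ∑ i ∈ Finset.range k, ((-1 : ℂ) ^ i) * h (t + n * L / 2 - i * L) := by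
    intro k
    induction k with
    | zero => simpa using (show IsWeilTest fun _ : ℝ ↦ (0 : ℂ) by simpa using hh.const_mul 0)
    | succ k ih =>
      have h1 := ih.add ((hh.weilTranslate (k * L - n * L / 2)).const_mul ((-1 : ℂ) ^ k))
      convert h1 using 1
      funext t
      rw [Finset.sum_range_succ]
      simp only [Pi.add_apply, weilTranslate]
      ring_nf
  convert key (n + 1) using 1
  exact funext hG

/-- Support of the comb: `tsupport G ⊆ [−(nL/2 + δ), nL/2 + δ]` for `h ∈ C(δ)`, `L ≥ 0`. -/
theorem tsupport_comb_subset (hsupp : tsupport h ⊆ Icc (-δ) δ) (hL : 0 ≤ L) :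
    tsupport G ⊆ Icc (-(n * L / 2 + δ)) (n * L / 2 + δ) := by
  refine (isClosed_Icc.closure_subset_iff).2 fun t ht ↦ ?_
  rw [Function.mem_support, hG] at ht
  obtain ⟨i, hi, hne⟩ := Finset.exists_ne_zero_of_sum_ne_zero ht
  have hi' : (i : ℝ) ≤ n := by exact_mod_cast Nat.lt_succ_iff.1 (Finset.mem_range.1 hi)
  have hne' : h (t + n * L / 2 - i * L) ≠ 0 := fun h0 ↦ hne (by rw [h0, mul_zero])
  have := hsupp (subset_tsupport _ (Function.mem_support.2 hne'))
  rw [mem_Icc] at this ⊢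
  have hi0 : (0 : ℝ) ≤ i := Nat.cast_nonneg i
  constructor <;> nlinarith [this.1, this.2]

/-- **Lattice autocorrelations of the comb.** For `h ∈ C(δ)`, `2δ < L` and an integer lag `d` with `0 ≤ d ≤ n`:
`k_G(d·L) = (−1)^d·(n + 1 − d)·‖h‖₂²` (`k_G = G ⋆ G̃`; only the `n + 1 − d` block pairs at distance exactly `dL` interact). -/
theorem weilConv_weilReflect_comb_lag (hh : IsWeilTest h) (hsupp : tsupport h ⊆ Icc (-δ) δ) (hL : 2 * δ < L) {d : ℕ} (hd : d ≤ n) :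
    weilConv G (weilReflect G) (d * L) = ((-1 : ℂ) ^ d) * ((n : ℂ) + 1 - d) * (((∫ u : ℝ, ‖h u‖ ^ 2 : ℝ)) : ℂ) := by
  set N2 : ℂ := (((∫ u : ℝ, ‖h u‖ ^ 2 : ℝ)) : ℂ) with hN2
  set a : ℕ → ℝ → ℂ := fun i u ↦ ((-1 : ℂ) ^ i) * h (u + n * L / 2 - i * L) with ha
  have hGa : ∀ u, G u = ∑ i ∈ Finset.range (n + 1), a i u := fun u ↦ by rw [hG]
  have hblk : ∀ i : ℕ, IsWeilTest (a i) := fun i ↦ by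
    have := (hh.weilTranslate (i * L - n * L / 2)).const_mul ((-1 : ℂ) ^ i)
    convert this using 1; funext u; simp only [ha, weilTranslate]; ring_nf
  have hterm : ∀ i j : ℕ, Integrable fun u : ℝ ↦ a i u * conj (a j (u - d * L)) := fun i j ↦
    (hblk i).integrable_mul (Complex.continuous_conj.comp ((hblk j).1.continuous.comp (continuous_id.sub continuous_const)))
  have hpair : ∀ i j : ℕ, ∫ u : ℝ, a i u * conj (a j (u - d * L)) = if i = j + d then ((-1 : ℂ) ^ d) * N2 else 0 := by
    intro i j
    have hprod : ∀ u : ℝ, a i u * conj (a j (u - d * L)) =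
        ((-1 : ℂ) ^ (i + j)) * (h (u + n * L / 2 - i * L) * conj (h (u - d * L + n * L / 2 - j * L))) := by
      intro u
      simp only [ha, map_mul, map_pow, map_neg, map_one]
      ring
    simp_rw [hprod]
    rw [integral_const_mul]
    split_ifs with hij
    · subst hij
      have hshift : ∀ u : ℝ, h (u + n * L / 2 - ((j + d : ℕ) : ℝ) * L) * conj (h (u - d * L + n * L / 2 - j * L)) =
          (fun v : ℝ ↦ ((‖h v‖ ^ 2 : ℝ) : ℂ)) (u + (n * L / 2 - ((j + d : ℕ) : ℝ) * L)) := by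
        intro u
        have : u - d * L + n * L / 2 - j * L = u + (n * L / 2 - ((j + d : ℕ) : ℝ) * L) := by push_cast; ring
        rw [this, show u + n * L / 2 - ((j + d : ℕ) : ℝ) * L = u + (n * L / 2 - ((j + d : ℕ) : ℝ) * L) by ring,
          Complex.mul_conj, Complex.normSq_eq_norm_sq]
      simp_rw [hshift]
      rw [integral_add_right_eq_self (fun v : ℝ ↦ ((‖h v‖ ^ 2 : ℝ) : ℂ)), integral_complex_ofReal, ← hN2,
        show j + d + j = 2 * j + d by ring, pow_add, pow_mul]
      norm_num
    · have hz : ∀ u : ℝ, h (u + n * L / 2 - i * L) * conj (h (u - d * L + n * L / 2 - j * L)) = 0 := fun u ↦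
        block_mul_conj_block_eq_zero (n := n) hsupp hL (d := (d : ℤ)) (by exact_mod_cast hij) u
      simp_rw [hz]
      simp
  have hint : ∀ u : ℝ, G u * conj (G (u - d * L)) =
      ∑ i ∈ Finset.range (n + 1), ∑ j ∈ Finset.range (n + 1), a i u * conj (a j (u - d * L)) := by
    intro u
    rw [hGa, hGa, map_sum, Finset.sum_mul_sum]
  rw [weilConv_weilReflect_apply']
  simp_rw [hint]
  rw [integral_finsetSum _ fun i _ ↦ integrable_finsetSum _ fun j _ ↦ hterm i j]
  simp_rw [integral_finsetSum _ fun j _ ↦ hterm _ j, hpair]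
  rw [Finset.sum_comm]
  simp_rw [Finset.sum_ite_eq' (Finset.range (n + 1))]
  rw [Finset.sum_ite, Finset.sum_const_zero, add_zero, Finset.sum_const]
  have hcard : ((Finset.range (n + 1)).filter fun j ↦ j + d ∈ Finset.range (n + 1)) = Finset.range (n + 1 - d) := by
    ext j
    simp only [Finset.mem_filter, Finset.mem_range]
    omega
  rw [hcard, Finset.card_range, nsmul_eq_mul]
  push_cast [Nat.cast_sub (by omega : d ≤ n + 1)]
  ring

/-- `‖G‖₂² = (n+1)·‖h‖₂²` (the `d = 0` lag). -/
theorem integral_norm_sq_comb (hh : IsWeilTest h) (hsupp : tsupport h ⊆ Icc (-δ) δ) (hL : 2 * δ < L) :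
    ∫ u : ℝ, ‖G u‖ ^ 2 = ((n : ℝ) + 1) * ∫ u : ℝ, ‖h u‖ ^ 2 := by
  have h0 := weilConv_weilReflect_comb_lag hG hh hsupp hL (Nat.zero_le n)
  rw [Nat.cast_zero, zero_mul, weilConv_weilReflect_apply_zero, pow_zero, one_mul, Nat.cast_zero, sub_zero] at h0
  exact_mod_cast h0

/-! ## §3  Deleting `p` under the comb at spacing `log p`: the exact value and the SHARPNESS of `2·log p/(√p + 1)` -/

variable {S : Finset ℕ} {p : ℕ}

/-- **The comb under deletion (exact).** For `p ∈ S` prime, `L = log p`, a block `h ∈ C(δ)` with `2δ < log p`, and the alternating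
comb `G = Σ_{i≤n} (−1)^i h(· + nL/2 − iL)` (a test function on `[−(nL/2 + δ), nL/2 + δ]`, where exactly the powers `p, …, p^n` are visible):
`Re Q_{S∖p}(G) − Re Q_S(G) = 2·log p·‖h‖₂²·Σ_{d<n} (n − d)·(−1/√p)^{d+1}`. -/
theorem re_weilSemilocalQuadratic_erase_comb (hh : IsWeilTest h) (hsupp : tsupport h ⊆ Icc (-δ) δ) (hp : p.Prime)
    (hpS : p ∈ S) (hLp : L = Real.log p) (hδL : 2 * δ < L) :
    (weilSemilocalQuadratic (S.erase p) G).re - (weilSemilocalQuadratic S G).re =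
      2 * Real.log p * (∫ u : ℝ, ‖h u‖ ^ 2) * ∑ d ∈ Finset.range n, ((n : ℝ) - d) * (-(Real.sqrt p)⁻¹) ^ (d + 1) := by
  have hL0 : 0 < L := by rw [hLp]; exact Real.log_pos (by exact_mod_cast hp.one_lt)
  have hGt : IsWeilTest G := isWeilTest_comb hG hh
  have hGs : tsupport G ⊆ Icc (-(n * L / 2 + δ)) (n * L / 2 + δ) := tsupport_comb_subset hG hsupp hL0.le
  have hwin : 2 * (n * L / 2 + δ) < (n + 1) * Real.log p := by rw [← hLp]; linarith
  rw [re_weilSemilocalQuadratic_erase_sub_eq_sum_pow hGt hp hpS hGs hwin, Finset.mul_sum]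
  refine Finset.sum_congr rfl fun d hd ↦ ?_
  have hdn : d + 1 ≤ n := Finset.mem_range.1 hd
  have hlag := weilConv_weilReflect_comb_lag hG hh hsupp hδL hdn
  set k := weilConv G (weilReflect G) with hk
  -- `k(−x) = conj k(x)`, so `Re(k(x) + k(−x)) = 2 Re k(x)`
  have hre : ∀ x : ℝ, (k x + k (-x)).re = 2 * (k x).re := by
    intro x
    have h1 : k (-x) = conj (k x) := by
      have := conj_weilConv_weilReflect_neg G x
      rw [← hk] at this
      rw [← this, Complex.conj_conj]
    rw [Complex.add_re, h1, Complex.conj_re]; ring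
  have hx : ((d : ℝ) + 1) * Real.log p = ((d + 1 : ℕ) : ℝ) * L := by rw [hLp]; push_cast; ring
  rw [hx, hre, hlag]
  have hval : ((-1 : ℂ) ^ (d + 1) * ((n : ℂ) + 1 - ((d + 1 : ℕ) : ℂ)) * (((∫ u : ℝ, ‖h u‖ ^ 2 : ℝ)) : ℂ)) =
      ((((-1 : ℝ) ^ (d + 1) * ((n : ℝ) - d) * ∫ u : ℝ, ‖h u‖ ^ 2 : ℝ)) : ℂ) := by
    push_cast; ring
  rw [hval, Complex.ofReal_re]
  have hsq : Real.sqrt p ^ (d + 1) ≠ 0 := pow_ne_zero _ (Real.sqrt_ne_zero'.2 (by exact_mod_cast hp.pos))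
  have hρ : (-(Real.sqrt p)⁻¹) ^ (d + 1) = (-1) ^ (d + 1) / Real.sqrt p ^ (d + 1) := by
    rw [neg_eq_neg_one_mul, mul_pow, inv_pow]; ring
  rw [hρ]
  field_simp

/-- **The comb beats every constant above the all-window floor.** With `F_p = 2·log p/(√p + 1)`:
`Re Q_{S∖p}(G) − Re Q_S(G) ≤ −F_p·((n − 1)/(n + 1))·‖G‖₂²` — the Rayleigh quotient of the deletion perturbation on the `(n+1)`-block
alternating comb is within `2F_p/(n+1)` of `−F_p`, so the constant of `SemilocalDeletionAllWindowFloor` (via `SemilocalDeletionCausalFilter`,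
p379019) cannot be improved. -/
theorem re_weilSemilocalQuadratic_erase_comb_le (hh : IsWeilTest h) (hsupp : tsupport h ⊆ Icc (-δ) δ) (hp : p.Prime)
    (hpS : p ∈ S) (hLp : L = Real.log p) (hδL : 2 * δ < L) :
    (weilSemilocalQuadratic (S.erase p) G).re - (weilSemilocalQuadratic S G).re ≤
      -(2 * Real.log p / (Real.sqrt p + 1)) * (((n : ℝ) - 1) / (n + 1)) * ∫ u : ℝ, ‖G u‖ ^ 2 := by
  rw [re_weilSemilocalQuadratic_erase_comb hG hh hsupp hp hpS hLp hδL, integral_norm_sq_comb hG hh hsupp hδL]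
  set ρ : ℝ := (Real.sqrt p)⁻¹ with hρ
  set T : ℝ := ∑ d ∈ Finset.range n, ((n : ℝ) - d) * (-ρ) ^ (d + 1) with hT
  set N : ℝ := ∫ u : ℝ, ‖h u‖ ^ 2 with hN
  have hsqrt1 : 1 < Real.sqrt p := by
    rw [show (1 : ℝ) = Real.sqrt 1 by simp]
    exact Real.sqrt_lt_sqrt (by norm_num) (by exact_mod_cast hp.one_lt)
  have hs0 : 0 < Real.sqrt p := by linarith
  have hρ0 : 0 ≤ ρ := by positivity
  have hρ1 : ρ < 1 := inv_lt_one_of_one_lt₀ hsqrt1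
  have hL0 : 0 < Real.log p := Real.log_pos (by exact_mod_cast hp.one_lt)
  have hN0 : 0 ≤ N := integral_nonneg fun u ↦ by positivity
  have hpn : (-ρ) ^ n ≤ 1 := by
    have : |(-ρ) ^ n| ≤ 1 := by rw [abs_pow, abs_neg, abs_of_nonneg hρ0]; exact pow_le_one₀ hρ0 hρ1.le
    exact (abs_le.1 this).2
  have hcl := comb_sum_closed (-ρ) n
  rw [← hT] at hcl
  -- `(1+ρ)·T ≤ −ρ·(n − 1)`
  have hkey : (1 + ρ) * T ≤ -(ρ * ((n : ℝ) - 1)) := by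
    have h1 : (1 + ρ) * ((1 + ρ) * T + ρ * ((n : ℝ) - 1)) = -(ρ * (1 + ρ)) - ρ ^ 2 * (1 - (-ρ) ^ n) := by
      have : (1 - -ρ) ^ 2 * T = (1 + ρ) * ((1 + ρ) * T) := by ring
      nlinarith [hcl]
    have h2 : (1 + ρ) * ((1 + ρ) * T + ρ * ((n : ℝ) - 1)) ≤ 0 := by
      rw [h1]; nlinarith [pow_nonneg hρ0 2]
    nlinarith
  -- constants: `2 log p/(√p + 1) = 2 log p·ρ/(1+ρ)`
  have hconst : 2 * Real.log p / (Real.sqrt p + 1) = 2 * Real.log p * ρ / (1 + ρ) := by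
    rw [hρ]; field_simp
  rw [hconst]
  have h1ρ : 0 < 1 + ρ := by linarith
  rw [show -(2 * Real.log p * ρ / (1 + ρ)) * (((n : ℝ) - 1) / (n + 1)) * (((n : ℝ) + 1) * N) =
      2 * Real.log p * N * (-(ρ * ((n : ℝ) - 1))) / (1 + ρ) by field_simp]
  rw [le_div_iff₀ h1ρ]
  have := mul_le_mul_of_nonneg_left hkey (by positivity : 0 ≤ 2 * Real.log p * N)
  nlinarith [this]

end Comb

/-- **SHARPNESS of the all-window floor, on every scale.** For `p ∈ S` prime and every `n`, there is a Weil test function `g` on the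
window `[−(n·log p/2 + log p/4), n·log p/2 + log p/4]` with `‖g‖₂² > 0` and
`Re Q_{S∖p}(g) − Re Q_S(g) ≤ −(2·log p/(√p + 1))·((n − 1)/(n + 1))·‖g‖₂²` (an `(n+1)`-block alternating comb). -/
theorem exists_re_weilSemilocalQuadratic_erase_sub_le {S : Finset ℕ} {p : ℕ} (hp : p.Prime) (hpS : p ∈ S) (n : ℕ) :
    ∃ g : ℝ → ℂ, IsWeilTest g ∧
      tsupport g ⊆ Icc (-(n * Real.log p / 2 + Real.log p / 4)) (n * Real.log p / 2 + Real.log p / 4) ∧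
      0 < ∫ u : ℝ, ‖g u‖ ^ 2 ∧
      (weilSemilocalQuadratic (S.erase p) g).re - (weilSemilocalQuadratic S g).re ≤
        -(2 * Real.log p / (Real.sqrt p + 1)) * (((n : ℝ) - 1) / (n + 1)) * ∫ u : ℝ, ‖g u‖ ^ 2 := by
  have hL0 : 0 < Real.log p := Real.log_pos (by exact_mod_cast hp.one_lt)
  obtain ⟨x, hx⟩ := semilocalSphereValues_top_nonempty S (a := Real.log p / 4) (by positivity)
  obtain ⟨h, hh, hs, -, hn1, -⟩ := hx
  set G : ℝ → ℂ := fun t ↦ ∑ i ∈ Finset.range (n + 1), ((-1 : ℂ) ^ i) * h (t + n * Real.log p / 2 - i * Real.log p) with hGdef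
  have hG : ∀ t, G t = ∑ i ∈ Finset.range (n + 1), ((-1 : ℂ) ^ i) * h (t + n * Real.log p / 2 - i * Real.log p) := fun _ ↦ rfl
  have hδL : 2 * (Real.log p / 4) < Real.log p := by linarith
  refine ⟨G, isWeilTest_comb hG hh, tsupport_comb_subset hG hs hL0.le, ?_, re_weilSemilocalQuadratic_erase_comb_le hG hh hs hp hpS rfl hδL⟩
  rw [integral_norm_sq_comb hG hh hs hδL, hn1, mul_one]
  positivity

end Summit.RiemannHypothesis.RiemannHypothesis.Theorems.SemilocalDeletionAllPowers

end
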